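import Literature.MathematicalPhysics.QuantumFieldTheory.Balaban1983to89.B1Eq324BenfattoClassCrossRowMass
import Literature.MathematicalPhysics.QuantumFieldTheory.Balaban1983to89.B1Eq324BenfattoClassCrossRowMassMoment
import Literature.MathematicalPhysics.QuantumFieldTheory.Balaban1983to89.B1Eq324BenfattoSect5LedgerDischarge
import HarnessLib

/-!
# `Balaban1983to89.B1Eq324BenfattoKernelSect5LedgerPrice` — [BenfattoEtAl1978] p. 152 (4.7), p. 159 «Collecting all the errors made in this process»
# for the class of [Balaban1985BackgroundPropagators] Sect. E p. 428: THE DECOUPLING PRICE `2P_k = 2(ρ_k + T_k/2)` of the class pavement step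
# (`…KernelSect5PavementChain.lowerPavementChain`) IN THE LEDGER'S CURRENCY — corridor-width rows for the guard, a closed |B|·L^d-extensive
# majorant, its two-regime absorption into `nI·errTerm`, and the narrow-width regime — PROVED

statement-level skeleton of published theorems with citation tags; proofs where landed; nothing here is a claim about the
Yang–Mills mass gap

WHY THIS MODULE (cell `pub-ymgap`, seat `dag-n08-b` gen 13; node N08 [Balaban1985UV3]; own lineage = the ledger-discharge toolkit
`…Sect5LedgerDischarge` / `…LedgerDischargeCumulant` / `…LedgerDischargeSums`).  Seat n08-d's class lower chain
`…KernelSect5PavementChain.lowerPavementChain` (the §5 pavement machinery of [BenfattoEtAl1978] run over a Gaussian of the class, print's exact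
Markov factorisation (5.13) replaced by the temperature-zero decoupling) pays, at every step `k`, the NEW price
`2P_k = 2·(ρ_k + T_k/2)`, `ρ_k = (Σ_y r_y)/(γ_A − J_c/(cosh θw − 1))`, `T_k = (1 + VM/(γ_A − J_c)·γ)²·b_k²·Σ_y r_y(1 + d(Δ_y, I_k + τ_k))²`
(the conditional / upper chain `…KernelSect5PavementChainUpper`: prefactor `(1 + VM/(γ_A − J_c))²`, sites outside `C_k + τ_k` as well),
`r_y = J_c/(cosh(θ·max(w, d(Δ_y, ∪_{□∈B_k}□))) − 1)` (sum over the sites of the frame outside the corridors `Γ₁(B_k)`), and carries the guard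
`J_c/(cosh θw − 1) < γ_A`.  Print's ledger (`…Sect5CollectErrors.ineq47_of_chain`'s `hledger`) has no such term; the class assembler's will.  This file
is that term's entry in the ledger, in the currency of the toolkit (`x ≤ nI·errTerm S_atom ρ₁ ρ₂ ρ₃ ρ₄ A b t` with `S_atom` closed): seat n08-w5's two
budgets `…ClassCrossRowMass.sum_crossRow_le_of_class_pavement` (`Σ_y r_y`) and `…ClassCrossRowMassMoment.sum_crossRow_mul_sq_le_of_class_pavement`
(`Σ_y r_y(1+d)²`) are |B|·L^d-extensive and carry `e^{−θw/2}`; two corridor-width rows `1 ≤ θw`, `4J_c/γ_A ≤ (θw)²` close the guard and the two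
denominators; the toolkit's `decay_atom_le_snd` absorbs `e^{−θw/2} = e^{−θv}` (`w = 2v`) in BOTH regimes of the parameter scheme.  Because the guard is
`w`-dependent, the bounded regime cannot use print's narrow corridors `v = 1` (`…LedgerDischarge` §2): §4 re-runs that § with a narrow width
`v₀ = v₀(θ, J_c, γ_A)` — still a constant of the free field, so the threshold `b*` stays in front of `∀ t D ϰ` as the knit
(`…Sect5BasicLemmaKnit.basicLemma_signed_of_ledgers`) requires.

WHAT IS PROVED (theorems only; no definition, no named fact, no `sorry`; axioms standard).
* §1 width rows (elementary): `div_cosh_sub_one_le_half_of_width` (`J_c/(cosh θw − 1) ≤ γ_A/2`), ★ `guard_of_width` (the chain's `hguard` FROM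
  `4J_c/γ_A ≤ (θw)²`, `0 < θw`, `0 < γ_A`), `half_le_gap_of_width` (`γ_A/2 ≤ γ_A − J_c/(cosh θw − 1)`), `two_div_one_sub_exp_sq_le_eight`
  (`2/(1 − e^{−t})² ≤ 8` for `t ≥ 1` — the prefactor of both budgets).
* §2 ★★ `two_mul_price_le_closed` — for any frame `Λ′`, boxes `B ≠ ∅` all meeting `I′`, `0 < L`, `0 < w`, and the two width rows:
  `2(ρ + T/2) ≤ (32(J_c/γ_A)·V_d(θ/2) + 8J_c·C_u·c²·(2(1+√d(L−1))² + 128/θ²)·V_d(θ/4))·(|B|·L^d)·e^{−θw/2}`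
  (`V_d(a) = (2e^{a/√d}/(1 − e^{−a/√d}))^d`), the chain's letters verbatim (centre prefactor `C_u` = the chain's `(1 + VM/(γ_A − J_c)·γ)²` as ONE
  letter, cut-off `c = b_k`); `two_mul_price_union_le_closed` (the same over the SMALLER index set `Λ′ ∖ (C′ ∪ Γ₁(B))` of seat n08-d's conditional /
  upper chain `…KernelSect5PavementChainUpper`); `boxes_meet_of_subset_image` (the row
  «every box meets `I′`» for `B ⊆ I′.image (boxIndex L)`, with the DESIGN NOTE «keep `B_k ≠ ∅`»: at `B = ∅` print's `d(Δ, ∅) = 0` junk value makes the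
  displayed price |Λ′|-extensive).
* §3 ★★ `two_mul_price_le_errTerm` — in the two-regime scheme (`L ≤ 2b²`, `w = 2v`, `hreg : b₀ ≤ b → M_reg·b^{3/2} ≤ v`, `ρ₃ + 1 ≤ θ·M_reg`,
  `|B| ≤ nI`, `0 ≤ c ≤ b`, `1 ≤ b`): `2(ρ + T/2) ≤ nI·errTerm S_P ρ₁ ρ₂ ρ₃ ρ₄ A b t` with `S_P` CLOSED, free of `s, b, c, L, A, nI, |Λ′|`;
  `two_mul_price_union_le_errTerm` (conditional / upper chain); `appendixA_class_term_le_snd` (the chain's terminal class Appendix-A loss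
  `4·8^d·e^{−c²/(2(1/γ_A))}`, `c ≥ γ^{d+1}b`, into the second summand via `…ErrTermLedger.appendixA_term_le_snd`); `sum_le_card_mul_of_le`
  (the `range (d+1)` sum).
* §4 the regime with a narrow width `v₀` (`v = if b₀ ≤ b then ⌈M_reg·b^{3/2}⌉₊ else v₀`, `w = 2v`, `L = ⌈b²⌉₊`): `one_le_regimeV₀`, `le_regimeV₀`
  (`v₀ ≤ v` in both regimes from `v₀ ≤ M_reg·b₀^{3/2}`), `wide_of_regime₀`, ★ `shifts_fit_regime₀` (`(d+1)·2(2w+v) ≤ L` from `10(d+1)v₀ ≤ b²` and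
  `(10(d+1)(M_reg+1))² ≤ b₀`), ★ `width_rows_of_le` (the two rows of §1–§3 at `w = 2v` from `1 ≤ 2θv₀`, `4J_c/γ_A ≤ (2θv₀)²`, `v₀ ≤ v`),
  `terminal_cutoff_of_threshold` (the chain's `hbterm : 4·(1/γ_A) ≤ b_{d+1}²` at `b_{d+1} = γ^{n}b` from `2/(γ^{n}√γ_A) ≤ b`).

HONEST SCOPE / NOT HERE.  Elementary real analysis over two landed lattice sums; no measure theory; the class and the substitute for (5.13) are
OURS, not print's; which losses the class assembler lists, the class chains, the ∃-knit and any «generalised Basic Lemma» are NOT here and not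
stated; count-neutral for N08; nothing of [Balaban1985UV3] (41)/(47)/(5) is asserted; nothing about d = 4, the continuum, OS axioms, a mass gap
or the Clay problem.
-/

noncomputable section

open Finset
open scoped BigOperators Nat

namespace Literature.MathematicalPhysics.QuantumFieldTheory.Balaban1983to89.B1Eq324BenfattoKernelSect5LedgerPrice

open Literature.MathematicalPhysics.QuantumFieldTheory.Balaban1983to89.B1Eq324BenfattoLemma
open Literature.MathematicalPhysics.QuantumFieldTheory.Balaban1983to89.B1Eq324BenfattoSect5Boxes
open Literature.MathematicalPhysics.QuantumFieldTheory.Balaban1983to89.B1Eq324BenfattoClassCrossRowMass (sum_crossRow_le_of_class_pavement)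
open Literature.MathematicalPhysics.QuantumFieldTheory.Balaban1983to89.B1Eq324BenfattoClassCrossRowMassMoment
  (sum_crossRow_mul_sq_le_of_class_pavement)
open Literature.MathematicalPhysics.QuantumFieldTheory.Balaban1983to89.B1Eq324BenfattoSect5ErrTermLedger
  (le_errTerm_of_le_snd shifts_fit sq_le_natCeil_sq appendixA_term_le_snd)
open Literature.MathematicalPhysics.QuantumFieldTheory.Balaban1983to89.B1Eq324BenfattoSect5LedgerDischarge (decay_atom_le_snd)

/-! ## §1  Corridor-width rows: the guard, the gap, the budget prefactor -/

section Width

variable {θ w Jc γA : ℝ}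

/-- kernel: `t²/2 ≤ cosh t − 1` (`cosh t = 1 + 2 sinh²(t/2)`, `x ≤ sinh x` for `x ≥ 0`; the tree has public twins in unrelated areas,
e.g. `Literature.Probability.LatticeModels.sq_div_two_le_cosh_sub_one`, not imported here). [folklore] -/
private theorem half_sq_le_cosh_sub_one (t : ℝ) : t ^ 2 / 2 ≤ Real.cosh t - 1 := by
  wlog ht : 0 ≤ t generalizing t
  · have := this (-t) (by linarith)
    rwa [neg_sq, Real.cosh_neg] at this
  have h := Real.cosh_two_mul (t / 2)
  rw [show 2 * (t / 2) = t by ring, Real.cosh_sq] at h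
  have h1 : t / 2 ≤ Real.sinh (t / 2) := Real.self_le_sinh_iff.2 (by linarith)
  have h2 : 0 ≤ t / 2 := by linarith
  nlinarith [mul_le_mul h1 h1 h2 (h2.trans h1)]

/-- **The maximal cross row is at most half the coercivity constant**: `J_c/(cosh θw − 1) ≤ γ_A/2` as soon as `4J_c/γ_A ≤ (θw)²`
(`0 < θw`, `0 < γ_A`; any sign of `J_c`) — since `cosh θw − 1 ≥ (θw)²/2 ≥ 2J_c/γ_A`.
[cite: BenfattoEtAl1978, §5 (5.13) p.155 (class substitute; ours); Balaban1985BackgroundPropagators, Sect. E p.428] -/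
theorem div_cosh_sub_one_le_half_of_width (hγA : 0 < γA) (hθw : 0 < θ * w) (hW : 4 * Jc / γA ≤ (θ * w) ^ 2) :
    Jc / (Real.cosh (θ * w) - 1) ≤ γA / 2 := by
  have hc : 0 < Real.cosh (θ * w) - 1 := by linarith [Real.one_lt_cosh.mpr hθw.ne']
  have hcosh : 2 * Jc / γA ≤ Real.cosh (θ * w) - 1 := by
    have h := half_sq_le_cosh_sub_one (θ * w)
    have : 2 * Jc / γA = (4 * Jc / γA) / 2 := by ring
    rw [this]
    linarith
  rw [div_le_iff₀ hc]
  have h2 : Jc = γA / 2 * (2 * Jc / γA) := by field_simp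
  calc Jc = γA / 2 * (2 * Jc / γA) := h2
    _ ≤ γA / 2 * (Real.cosh (θ * w) - 1) := mul_le_mul_of_nonneg_left hcosh (by linarith)

/-- **THE GUARD OF THE CLASS PAVEMENT STEP FROM A CORRIDOR-WIDTH ROW**: `J_c/(cosh θw − 1) < γ_A` (the `hguard` of
`…KernelSect5PavementChain.lowerPavementChain` / `…KernelSect5ClassRows.pavementStep_of_classRows`) as soon as `4J_c/γ_A ≤ (θw)²`, `0 < θw`,
`0 < γ_A`. [cite: BenfattoEtAl1978, §5 (5.13) p.155 (class substitute; ours); Balaban1985BackgroundPropagators, Sect. E p.428] -/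
theorem guard_of_width (hγA : 0 < γA) (hθw : 0 < θ * w) (hW : 4 * Jc / γA ≤ (θ * w) ^ 2) :
    Jc / (Real.cosh (θ * w) - 1) < γA :=
  lt_of_le_of_lt (div_cosh_sub_one_le_half_of_width hγA hθw hW) (by linarith)

/-- **The decoupling denominator is at least half the coercivity constant**: `γ_A/2 ≤ γ_A − J_c/(cosh θw − 1)` under the same row.
[cite: BenfattoEtAl1978, §5 (5.13) p.155 (class substitute; ours)] -/
theorem half_le_gap_of_width (hγA : 0 < γA) (hθw : 0 < θ * w) (hW : 4 * Jc / γA ≤ (θ * w) ^ 2) :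
    γA / 2 ≤ γA - Jc / (Real.cosh (θ * w) - 1) := by
  linarith [div_cosh_sub_one_le_half_of_width hγA hθw hW]

/-- **The budgets' prefactor is at most `8`**: `2/(1 − e^{−t})² ≤ 8` for `t ≥ 1` (`e^{−t} ≤ e^{−1} ≤ 1/2`).
[cite: BenfattoEtAl1978, §5 (5.13) p.155 (class substitute; ours)] -/
theorem two_div_one_sub_exp_sq_le_eight {t : ℝ} (ht : 1 ≤ t) : 2 / (1 - Real.exp (-t)) ^ 2 ≤ 8 := by
  have he : Real.exp (-t) ≤ 1 / 2 := by
    have h1 : Real.exp (-t) ≤ Real.exp (-1) := Real.exp_le_exp.mpr (by linarith)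
    have h2 : Real.exp (-1) ≤ 1 / 2 := by
      rw [Real.exp_neg, one_div, inv_le_inv₀ (Real.exp_pos 1) (by norm_num : (0 : ℝ) < 2)]
      have := Real.exp_one_gt_d9
      linarith
    exact h1.trans h2
  have hpos : 0 < Real.exp (-t) := Real.exp_pos _
  have hq : 1 / 4 ≤ (1 - Real.exp (-t)) ^ 2 := by nlinarith
  rw [div_le_iff₀ (lt_of_lt_of_le (by norm_num) hq)]
  linarith

end Width

/-! ## §2  The price in closed form: |B|·L^d-extensive, exponentially small in the corridor width -/

section Closed

variable {d : ℕ}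

/-- kernel: the growth constant `V_d(a) = (2e^{a}/(1 − e^{−a}))^n` is non-negative for `a ≥ 0` (base `≥ 0`; at `a = 0` Lean's `2/0 = 0`). [folklore] -/
private theorem growth_nonneg {a : ℝ} (ha : 0 ≤ a) (n : ℕ) : 0 ≤ (2 / (1 - Real.exp (-a)) * Real.exp a) ^ n :=
  pow_nonneg (mul_nonneg (div_nonneg zero_le_two (by linarith [Real.exp_le_one_iff.mpr (neg_nonpos.mpr ha)]))
    (Real.exp_pos a).le) n

/-- **THE DECOUPLING PRICE OF ONE CLASS PAVEMENT STEP, CLOSED FORM.**  In any frame `Λ′` (a `Finset` of sites), for print's pavement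
(`0 < L`, corridors of width `w > 0`), a non-empty set `B` of boxes EACH MEETING `I′` (the assembler's `B` = the tesserae meeting `J + τ ⊆ I + τ`),
class constants `θ > 0` (Combes–Thomas rate), `J_c ≥ 0` (row defect), `γ_A > 0` (coercivity), a centre-budget prefactor `C_u ≥ 0` (the chain's
`(1 + VM/(γ_A − J_c)·γ)²`, resp. `(1 + VM/(γ_A − J_c))²` on the conditional chain — any non-negative real), a cut-off `c`, and the two width rows
`1 ≤ θw`, `4J_c/γ_A ≤ (θw)²`, the price `2(ρ + T/2)` displayed in `…KernelSect5PavementChain.lowerPavementChain` (letters verbatim: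
`r_y = J_c/(cosh(θ·max(w, d(Δ_y, ∪_{□∈B}□))) − 1)` over `y ∈ Λ′ ∖ Γ₁(B)`, `ρ = Σ_y r_y/(γ_A − J_c/(cosh θw − 1))`,
`T = C_u·c²·Σ_y r_y(1 + d(Δ_y, I′))²`) satisfies
`2(ρ + T/2) ≤ (32(J_c/γ_A)·V_d(θ/2) + 8J_c·C_u·c²·(2(1 + √d(L−1))² + 128/θ²)·V_d(θ/4))·(|B|·L^d)·e^{−θw/2}`,
`V_d(a) = (2e^{a/√d}/(1 − e^{−a/√d}))^d` — seat n08-w5's `sum_crossRow_le_of_class_pavement` and `sum_crossRow_mul_sq_le_of_class_pavement`, the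
gap `≥ γ_A/2` (`half_le_gap_of_width`) and the prefactor `2/(1 − e^{−θw})² ≤ 8`.  |Λ′|-FREE, |B|-extensive.
[cite: BenfattoEtAl1978, §5 (5.13)–(5.15) p.155, p.159 «Collecting all the errors» (class substitute; ours); Balaban1985BackgroundPropagators, Sect. E p.428] -/
theorem two_mul_price_le_closed {Λ B I : Finset (B1Eq324BenfattoLemma.Site d)} {θ Jc γA Cu c : ℝ} {L w : ℕ}
    (hθ : 0 < θ) (hJc : 0 ≤ Jc) (hγA : 0 < γA) (hCu : 0 ≤ Cu) (hL : 0 < L) (hw : 0 < w) (hB : B.Nonempty)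
    (hBI : ∀ m ∈ B, ∃ x ∈ box L m, x ∈ I)
    (hW1 : 1 ≤ θ * w) (hW2 : 4 * Jc / γA ≤ (θ * w) ^ 2) :
    2 * ((∑ y : ↥(Λ \ corridors L w B), Jc / (Real.cosh (θ * max (w : ℝ) (distToRegion (B.biUnion (box L)) y)) - 1)) /
          (γA - Jc / (Real.cosh (θ * w) - 1)) +
        (Cu * c ^ 2 *
          ∑ y : ↥(Λ \ corridors L w B), Jc / (Real.cosh (θ * max (w : ℝ) (distToRegion (B.biUnion (box L)) y)) - 1) *
            (1 + distToRegion I y) ^ 2) / 2)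
      ≤ (32 * (Jc / γA) * (2 / (1 - Real.exp (-(θ / 2 / Real.sqrt d))) * Real.exp (θ / 2 / Real.sqrt d)) ^ d +
          8 * Jc * Cu * c ^ 2 *
            ((2 * (1 + Real.sqrt d * ((L : ℝ) - 1)) ^ 2 + 128 / θ ^ 2) *
              (2 / (1 - Real.exp (-(θ / 4 / Real.sqrt d))) * Real.exp (θ / 4 / Real.sqrt d)) ^ d)) *
        ((B.card : ℝ) * (L : ℝ) ^ d) * Real.exp (-(θ * w / 2)) := by
  -- abbreviations (local, no definitions)
  set S₁ : ℝ := ∑ y : ↥(Λ \ corridors L w B), Jc / (Real.cosh (θ * max (w : ℝ) (distToRegion (B.biUnion (box L)) y)) - 1) with hS₁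
  set S₂ : ℝ := ∑ y : ↥(Λ \ corridors L w B), Jc / (Real.cosh (θ * max (w : ℝ) (distToRegion (B.biUnion (box L)) y)) - 1) *
    (1 + distToRegion I y) ^ 2 with hS₂
  set V₂ : ℝ := (2 / (1 - Real.exp (-(θ / 2 / Real.sqrt d))) * Real.exp (θ / 2 / Real.sqrt d)) ^ d with hV₂
  set W₄ : ℝ := (2 * (1 + Real.sqrt d * ((L : ℝ) - 1)) ^ 2 + 128 / θ ^ 2) *
    (2 / (1 - Real.exp (-(θ / 4 / Real.sqrt d))) * Real.exp (θ / 4 / Real.sqrt d)) ^ d with hW₄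
  set P : ℝ := (B.card : ℝ) * (L : ℝ) ^ d with hP
  set E : ℝ := Real.exp (-(θ * w / 2)) with hE
  set g : ℝ := γA - Jc / (Real.cosh (θ * w) - 1) with hg
  -- the two budgets (seat n08-w5), in the letters above
  have hw' : (0 : ℝ) < w := by exact_mod_cast hw
  have hθw : 0 < θ * w := mul_pos hθ hw'
  have h1 : S₁ ≤ 2 * Jc / (1 - Real.exp (-(θ * w))) ^ 2 * Real.exp (-(θ * w / 2)) * P * V₂ := by
    rw [hS₁, hP, hV₂]
    exact sum_crossRow_le_of_class_pavement (Λ := Λ) hθ hJc hL hw hB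
  have h2 : S₂ ≤ 2 * Jc / (1 - Real.exp (-(θ * w))) ^ 2 * Real.exp (-(θ * w / 2)) * P * W₄ := by
    rw [hS₂, hP, hW₄]
    exact sum_crossRow_mul_sq_le_of_class_pavement (Λ := Λ) hθ hJc hL hw hB hBI
  -- the prefactor `2J_c/(1 − e^{−θw})² ≤ 8J_c`
  have h8 : 2 / (1 - Real.exp (-(θ * w))) ^ 2 ≤ 8 := two_div_one_sub_exp_sq_le_eight hW1
  have hpre : 2 * Jc / (1 - Real.exp (-(θ * w))) ^ 2 ≤ 8 * Jc := by
    rw [show 2 * Jc / (1 - Real.exp (-(θ * w))) ^ 2 = Jc * (2 / (1 - Real.exp (-(θ * w))) ^ 2) by ring]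
    nlinarith
  -- signs
  have hE0 : 0 ≤ E := (Real.exp_pos _).le
  have hP0 : 0 ≤ P := by rw [hP]; positivity
  have hV₂0 : 0 ≤ V₂ := by rw [hV₂]; exact growth_nonneg (by positivity) d
  have hW₄0 : 0 ≤ W₄ := by rw [hW₄]; exact mul_nonneg (by positivity) (growth_nonneg (by positivity) d)
  have hS₁0 : 0 ≤ S₁ := by
    rw [hS₁]
    refine Finset.sum_nonneg fun y _ => div_nonneg hJc ?_
    have hmax : θ * w ≤ θ * max (w : ℝ) (distToRegion (B.biUnion (box L)) y) := mul_le_mul_of_nonneg_left (le_max_left _ _) hθ.le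
    linarith [Real.one_lt_cosh.mpr (lt_of_lt_of_le hθw hmax).ne']
  have h1' : S₁ ≤ 8 * Jc * E * P * V₂ := by
    refine h1.trans ?_
    have : 0 ≤ Real.exp (-(θ * w / 2)) * P * V₂ := by positivity
    calc 2 * Jc / (1 - Real.exp (-(θ * w))) ^ 2 * Real.exp (-(θ * w / 2)) * P * V₂
        = 2 * Jc / (1 - Real.exp (-(θ * w))) ^ 2 * (Real.exp (-(θ * w / 2)) * P * V₂) := by ring
      _ ≤ 8 * Jc * (Real.exp (-(θ * w / 2)) * P * V₂) := mul_le_mul_of_nonneg_right hpre this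
      _ = 8 * Jc * E * P * V₂ := by rw [hE]; ring
  have h2' : S₂ ≤ 8 * Jc * E * P * W₄ := by
    refine h2.trans ?_
    have : 0 ≤ Real.exp (-(θ * w / 2)) * P * W₄ := by positivity
    calc 2 * Jc / (1 - Real.exp (-(θ * w))) ^ 2 * Real.exp (-(θ * w / 2)) * P * W₄
        = 2 * Jc / (1 - Real.exp (-(θ * w))) ^ 2 * (Real.exp (-(θ * w / 2)) * P * W₄) := by ring
      _ ≤ 8 * Jc * (Real.exp (-(θ * w / 2)) * P * W₄) := mul_le_mul_of_nonneg_right hpre this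
      _ = 8 * Jc * E * P * W₄ := by rw [hE]; ring
  -- the `ρ`-part: divide by the gap `≥ γ_A/2`
  have hgap : γA / 2 ≤ g := by rw [hg]; exact half_le_gap_of_width hγA hθw hW2
  have hg0 : 0 < g := lt_of_lt_of_le (by linarith) hgap
  have hρ : S₁ / g ≤ 2 / γA * (8 * Jc * E * P * V₂) := by
    rw [div_le_iff₀ hg0]
    have hstep : S₁ ≤ 2 / γA * S₁ * (γA / 2) := by
      have hγ : γA ≠ 0 := hγA.ne'
      have : 2 / γA * S₁ * (γA / 2) = S₁ := by field_simp
      rw [this]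
    calc S₁ ≤ 2 / γA * S₁ * (γA / 2) := hstep
      _ ≤ 2 / γA * S₁ * g := mul_le_mul_of_nonneg_left hgap (by positivity)
      _ ≤ 2 / γA * (8 * Jc * E * P * V₂) * g :=
          mul_le_mul_of_nonneg_right (mul_le_mul_of_nonneg_left h1' (by positivity)) hg0.le
  -- the `T`-part
  have hT : Cu * c ^ 2 * S₂ ≤ Cu * c ^ 2 * (8 * Jc * E * P * W₄) := mul_le_mul_of_nonneg_left h2' (by positivity)
  -- assemble
  have hlhs : 2 * (S₁ / g + Cu * c ^ 2 * S₂ / 2) = 2 * (S₁ / g) + Cu * c ^ 2 * S₂ := by ring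
  rw [hlhs]
  calc 2 * (S₁ / g) + Cu * c ^ 2 * S₂
      ≤ 2 * (2 / γA * (8 * Jc * E * P * V₂)) + Cu * c ^ 2 * (8 * Jc * E * P * W₄) := by linarith
    _ = (32 * (Jc / γA) * V₂ + 8 * Jc * Cu * c ^ 2 * W₄) * P * E := by ring

/-- **The row `hBI` for the assembler's natural pavements**: if every box of `B` is the tessera of a point of `I′` (`B ⊆ I′.image (boxIndex L)`,
`0 < L`) — e.g. `B` = the tesserae meeting `J′ ⊆ I′`, or `B` = ALL tesserae meeting `I′` (then also `B ≠ ∅` from `I′ ≠ ∅` and `|B| ≤ |I′|` by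
`Finset.card_image_le`) — then every box of `B` meets `I′`.  DESIGN NOTE for the class assembler: keep `B_k ≠ ∅` at EVERY step (at `B = ∅` print's
`d(Δ_y, ∅)` is the junk value `0`, so the displayed price charges `J_c/(cosh θw − 1)` to every site of the frame — |Λ′|-extensive); the choice
`B_k :=` the tesserae meeting `I_k + τ_k` is never empty, has `|B_k| ≤ |I|`, and contains the tesserae meeting `J_k + τ_k`.
[cite: BenfattoEtAl1978, §5 (5.7) p.154 «the boxes … near I»] -/
theorem boxes_meet_of_subset_image {L : ℕ} (hL : 0 < L) {I B : Finset (B1Eq324BenfattoLemma.Site d)} (hB : B ⊆ I.image (boxIndex L)) :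
    ∀ m ∈ B, ∃ x ∈ box L m, x ∈ I := by
  intro m hm
  obtain ⟨x, hxI, hxm⟩ := Finset.mem_image.mp (hB hm)
  exact ⟨x, hxm ▸ mem_box_boxIndex hL x, hxI⟩

/-- kernel: a sum over the sites outside `C ∪ Γ` is the same sum over the sites of `Λ ∖ C` outside `Γ` (index transport along
`Λ ∖ (C ∪ Γ) = (Λ ∖ C) ∖ Γ`). [folklore] -/
private theorem sum_sdiff_union_eq (Λ C G : Finset (B1Eq324BenfattoLemma.Site d)) (F : B1Eq324BenfattoLemma.Site d → ℝ) :
    ∑ y : ↥(Λ \ (C ∪ G)), F y = ∑ y : ↥((Λ \ C) \ G), F y :=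
  Fintype.sum_equiv (Equiv.subtypeEquivRight fun y => by
      simp only [Finset.mem_sdiff, Finset.mem_union, not_or, and_assoc]) _ _ fun _ => rfl

/-- **THE PRICE OF THE CONDITIONAL / UPPER CLASS STEP, CLOSED FORM** — the same bound for the price displayed in seat n08-d's
`…KernelSect5PavementChainUpper.upperPavementChainCond`, whose cross rows run over the SMALLER index set `Λ′ ∖ (C′ ∪ Γ₁(B))` (the conditioning set
removed): `two_mul_price_le_closed` for the frame `Λ′ ∖ C′` after the index transport `Λ′ ∖ (C′ ∪ Γ₁) = (Λ′ ∖ C′) ∖ Γ₁`.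
[cite: BenfattoEtAl1978, §5 (5.36) p.159, (4.6) p.152 (class substitute; ours); Balaban1985BackgroundPropagators, Sect. E p.428] -/
theorem two_mul_price_union_le_closed {Λ C B I : Finset (B1Eq324BenfattoLemma.Site d)} {θ Jc γA Cu c : ℝ} {L w : ℕ}
    (hθ : 0 < θ) (hJc : 0 ≤ Jc) (hγA : 0 < γA) (hCu : 0 ≤ Cu) (hL : 0 < L) (hw : 0 < w) (hB : B.Nonempty)
    (hBI : ∀ m ∈ B, ∃ x ∈ box L m, x ∈ I)
    (hW1 : 1 ≤ θ * w) (hW2 : 4 * Jc / γA ≤ (θ * w) ^ 2) :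
    2 * ((∑ y : ↥(Λ \ (C ∪ corridors L w B)), Jc / (Real.cosh (θ * max (w : ℝ) (distToRegion (B.biUnion (box L)) y)) - 1)) /
          (γA - Jc / (Real.cosh (θ * w) - 1)) +
        (Cu * c ^ 2 *
          ∑ y : ↥(Λ \ (C ∪ corridors L w B)), Jc / (Real.cosh (θ * max (w : ℝ) (distToRegion (B.biUnion (box L)) y)) - 1) *
            (1 + distToRegion I y) ^ 2) / 2)
      ≤ (32 * (Jc / γA) * (2 / (1 - Real.exp (-(θ / 2 / Real.sqrt d))) * Real.exp (θ / 2 / Real.sqrt d)) ^ d +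
          8 * Jc * Cu * c ^ 2 *
            ((2 * (1 + Real.sqrt d * ((L : ℝ) - 1)) ^ 2 + 128 / θ ^ 2) *
              (2 / (1 - Real.exp (-(θ / 4 / Real.sqrt d))) * Real.exp (θ / 4 / Real.sqrt d)) ^ d)) *
        ((B.card : ℝ) * (L : ℝ) ^ d) * Real.exp (-(θ * w / 2)) := by
  have e1 : ∑ y : ↥(Λ \ (C ∪ corridors L w B)), Jc / (Real.cosh (θ * max (w : ℝ) (distToRegion (B.biUnion (box L)) y)) - 1) =
      ∑ y : ↥((Λ \ C) \ corridors L w B), Jc / (Real.cosh (θ * max (w : ℝ) (distToRegion (B.biUnion (box L)) y)) - 1) :=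
    sum_sdiff_union_eq Λ C (corridors L w B) fun y => Jc / (Real.cosh (θ * max (w : ℝ) (distToRegion (B.biUnion (box L)) y)) - 1)
  have e2 : ∑ y : ↥(Λ \ (C ∪ corridors L w B)), Jc / (Real.cosh (θ * max (w : ℝ) (distToRegion (B.biUnion (box L)) y)) - 1) *
        (1 + distToRegion I y) ^ 2 =
      ∑ y : ↥((Λ \ C) \ corridors L w B), Jc / (Real.cosh (θ * max (w : ℝ) (distToRegion (B.biUnion (box L)) y)) - 1) *
        (1 + distToRegion I y) ^ 2 :=
    sum_sdiff_union_eq Λ C (corridors L w B) fun y =>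
      Jc / (Real.cosh (θ * max (w : ℝ) (distToRegion (B.biUnion (box L)) y)) - 1) * (1 + distToRegion I y) ^ 2
  rw [e1, e2]
  exact two_mul_price_le_closed (Λ := Λ \ C) hθ hJc hγA hCu hL hw hB hBI hW1 hW2

end Closed

/-! ## §3  Into the ledger: the price fits `nI·errTerm S_P …` in both regimes -/

section Ledger

variable {d : ℕ}

/-- kernel: the `L`-dependence of the moment constant under `L ≤ 2b²`, `b ≥ 1`: `2(1 + √d(L−1))² + 128/θ² ≤ (2(1 + 2√d)² + 128/θ²)·b⁴`. [folklore] -/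
private theorem moment_const_le {θ b : ℝ} {L : ℕ} (hθ : 0 < θ) (hb : 1 ≤ b) (hLb : (L : ℝ) ≤ 2 * b ^ 2) :
    2 * (1 + Real.sqrt d * ((L : ℝ) - 1)) ^ 2 + 128 / θ ^ 2 ≤ (2 * (1 + 2 * Real.sqrt d) ^ 2 + 128 / θ ^ 2) * b ^ 4 := by
  have hd : 0 ≤ Real.sqrt d := Real.sqrt_nonneg _
  have hb2 : 1 ≤ b ^ 2 := by nlinarith
  have hb4 : 1 ≤ b ^ 4 := by nlinarith
  have hL0 : (0 : ℝ) ≤ L := Nat.cast_nonneg L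
  have hlin : 1 + Real.sqrt d * ((L : ℝ) - 1) ≤ (1 + 2 * Real.sqrt d) * b ^ 2 := by
    have : Real.sqrt d * ((L : ℝ) - 1) ≤ Real.sqrt d * (2 * b ^ 2) := mul_le_mul_of_nonneg_left (by linarith) hd
    nlinarith
  have hlo : -((1 + 2 * Real.sqrt d) * b ^ 2) ≤ 1 + Real.sqrt d * ((L : ℝ) - 1) := by
    have h1 : -1 ≤ (L : ℝ) - 1 := by linarith
    have : Real.sqrt d * (-1) ≤ Real.sqrt d * ((L : ℝ) - 1) := mul_le_mul_of_nonneg_left h1 hd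
    nlinarith
  have hsq : (1 + Real.sqrt d * ((L : ℝ) - 1)) ^ 2 ≤ ((1 + 2 * Real.sqrt d) * b ^ 2) ^ 2 := sq_le_sq' hlo hlin
  have h128 : 128 / θ ^ 2 ≤ 128 / θ ^ 2 * b ^ 4 := le_mul_of_one_le_right (by positivity) hb4
  nlinarith

/-- **THE DECOUPLING PRICE IN THE LEDGER, BOTH REGIMES.**  In the parameter scheme of `…Sect5LedgerDischarge` §2 / §4 below (tesserae
`L ≤ 2b²`, corridors `w = 2v` with the wide-regime row `b₀ ≤ b → M_reg·b^{3/2} ≤ v` and `ρ₃ + 1 ≤ θ·M_reg`, `ρ₃ ≥ 0`, `ρ₄ ≥ 1`, `b₀ ≥ 0`), at a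
cut-off `0 ≤ c ≤ b` (`b ≥ 1`), with `|B| ≤ nI`, `A ≥ 0` and the hypotheses of `two_mul_price_le_closed`, the price of one class pavement step obeys
`2(ρ + T/2) ≤ nI·errTerm S_P ρ₁ ρ₂ ρ₃ ρ₄ A b t` with the CLOSED constant
`S_P = 2^d·(32(J_c/γ_A)V_d(θ/2) + 8J_c·C_u·(2(1+2√d)² + 128/θ²)V_d(θ/4))·((2d+6)! + b₀^{2d+6}e^{ρ₃b₀^{3/2}})`, free of
`s, b, c, L, A, nI` and of the frame: `|B|·L^d ≤ nI·2^d·b^{2d}`, `c² ≤ b²`, `moment ≤ (…)·b⁴`, then `…LedgerDischarge.decay_atom_le_snd` at rate `θ` and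
width `X = v` (`e^{−θw/2} = e^{−θv}`), and `…ErrTermLedger.le_errTerm_of_le_snd`.
[cite: BenfattoEtAl1978, (4.7) p.152, §5 (5.13)–(5.15) p.155, p.159 «Collecting all the errors made in this process» (class substitute; ours);
Balaban1985BackgroundPropagators, Sect. E p.428] -/
theorem two_mul_price_le_errTerm {Λ B I : Finset (B1Eq324BenfattoLemma.Site d)} {θ Jc γA Cu c b b₀ Mreg ρ₁ ρ₂ ρ₃ ρ₄ A nI : ℝ} {L w v : ℕ}
    {t : ℕ} (hθ : 0 < θ) (hJc : 0 ≤ Jc) (hγA : 0 < γA) (hCu : 0 ≤ Cu) (hL : 0 < L) (hB : B.Nonempty)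
    (hBI : ∀ m ∈ B, ∃ x ∈ box L m, x ∈ I)
    (hW1 : 1 ≤ θ * w) (hW2 : 4 * Jc / γA ≤ (θ * w) ^ 2)
    (hb : 1 ≤ b) (hc0 : 0 ≤ c) (hcb : c ≤ b) (hLb : (L : ℝ) ≤ 2 * b ^ 2) (hwv : w = 2 * v) (hv : 1 ≤ v)
    (hBn : (B.card : ℝ) ≤ nI) (hA : 0 ≤ A) (hb₀ : 0 ≤ b₀) (hρ₃ : 0 ≤ ρ₃) (hρ₄ : 1 ≤ ρ₄)
    (hreg : b₀ ≤ b → Mreg * b ^ (3 / 2 : ℝ) ≤ (v : ℝ)) (hM : ρ₃ + 1 ≤ θ * Mreg) :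
    2 * ((∑ y : ↥(Λ \ corridors L w B), Jc / (Real.cosh (θ * max (w : ℝ) (distToRegion (B.biUnion (box L)) y)) - 1)) /
          (γA - Jc / (Real.cosh (θ * w) - 1)) +
        (Cu * c ^ 2 *
          ∑ y : ↥(Λ \ corridors L w B), Jc / (Real.cosh (θ * max (w : ℝ) (distToRegion (B.biUnion (box L)) y)) - 1) *
            (1 + distToRegion I y) ^ 2) / 2)
      ≤ nI * errTerm
          ((2 ^ d * (32 * (Jc / γA) * (2 / (1 - Real.exp (-(θ / 2 / Real.sqrt d))) * Real.exp (θ / 2 / Real.sqrt d)) ^ d +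
              8 * Jc * Cu * (2 * (1 + 2 * Real.sqrt d) ^ 2 + 128 / θ ^ 2) *
                (2 / (1 - Real.exp (-(θ / 4 / Real.sqrt d))) * Real.exp (θ / 4 / Real.sqrt d)) ^ d)) *
            (((2 * d + 6).factorial : ℝ) + b₀ ^ (2 * d + 6) * Real.exp (ρ₃ * b₀ ^ (3 / 2 : ℝ))))
          ρ₁ ρ₂ ρ₃ ρ₄ A b t := by
  have hw : 0 < w := by omega
  -- Step 1: the closed form
  have hclosed := two_mul_price_le_closed (Λ := Λ) (c := c) hθ hJc hγA hCu hL hw hB hBI hW1 hW2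
  -- abbreviations
  set V₂ : ℝ := (2 / (1 - Real.exp (-(θ / 2 / Real.sqrt d))) * Real.exp (θ / 2 / Real.sqrt d)) ^ d with hV₂
  set V₄ : ℝ := (2 / (1 - Real.exp (-(θ / 4 / Real.sqrt d))) * Real.exp (θ / 4 / Real.sqrt d)) ^ d with hV₄
  set K₀ : ℝ := 2 * (1 + 2 * Real.sqrt d) ^ 2 + 128 / θ ^ 2 with hK₀
  set C₀ : ℝ := 32 * (Jc / γA) * V₂ + 8 * Jc * Cu * K₀ * V₄ with hC₀
  set snd : ℝ := Real.exp (-(ρ₃ * b ^ (3 / 2 : ℝ))) * Real.exp (ρ₄ * A * b ^ ρ₃) with hsnd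
  have hb0 : 0 ≤ b := zero_le_one.trans hb
  have hV₂0 : 0 ≤ V₂ := by rw [hV₂]; exact growth_nonneg (by positivity) d
  have hV₄0 : 0 ≤ V₄ := by rw [hV₄]; exact growth_nonneg (by positivity) d
  have hK₀0 : 0 ≤ K₀ := by rw [hK₀]; positivity
  have hC₀0 : 0 ≤ C₀ := by rw [hC₀]; positivity
  have hnI : 0 ≤ nI := le_trans (Nat.cast_nonneg _) hBn
  -- Step 2: polynomial normal form `≤ C₀·2^d·b^{2d+6}·e^{−θv}·nI`
  have hmom : 2 * (1 + Real.sqrt d * ((L : ℝ) - 1)) ^ 2 + 128 / θ ^ 2 ≤ K₀ * b ^ 4 := by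
    rw [hK₀]; exact moment_const_le hθ hb hLb
  have hc2 : c ^ 2 ≤ b ^ 2 := pow_le_pow_left₀ hc0 hcb 2
  have hLd : (L : ℝ) ^ d ≤ 2 ^ d * b ^ (2 * d) := by
    calc (L : ℝ) ^ d ≤ (2 * b ^ 2) ^ d := pow_le_pow_left₀ (Nat.cast_nonneg L) hLb d
      _ = 2 ^ d * b ^ (2 * d) := by rw [mul_pow, pow_mul]
  have hP : (B.card : ℝ) * (L : ℝ) ^ d ≤ nI * (2 ^ d * b ^ (2 * d)) :=
    mul_le_mul hBn hLd (by positivity) hnI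
  have hE : Real.exp (-(θ * w / 2)) = Real.exp (-(θ * (v : ℝ))) := by
    rw [hwv]; push_cast; ring_nf
  have hb6 : 1 ≤ b ^ 6 := one_le_pow₀ hb
  have hfirst : 32 * (Jc / γA) * V₂ ≤ 32 * (Jc / γA) * V₂ * b ^ 6 := le_mul_of_one_le_right (by positivity) hb6
  have hsecond : 8 * Jc * Cu * c ^ 2 * ((2 * (1 + Real.sqrt d * ((L : ℝ) - 1)) ^ 2 + 128 / θ ^ 2) * V₄) ≤
      8 * Jc * Cu * K₀ * V₄ * b ^ 6 := by
    have h1 : 8 * Jc * Cu * c ^ 2 * ((2 * (1 + Real.sqrt d * ((L : ℝ) - 1)) ^ 2 + 128 / θ ^ 2) * V₄) ≤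
        8 * Jc * Cu * b ^ 2 * ((K₀ * b ^ 4) * V₄) := by
      gcongr
    refine h1.trans (le_of_eq ?_)
    ring
  have hconst : (32 * (Jc / γA) * V₂ + 8 * Jc * Cu * c ^ 2 * ((2 * (1 + Real.sqrt d * ((L : ℝ) - 1)) ^ 2 + 128 / θ ^ 2) * V₄))
      ≤ C₀ * b ^ 6 := by
    rw [hC₀]
    linarith [hfirst, hsecond]
  have hC2 : 0 ≤ 2 ^ d * C₀ := by positivity
  have hnormal : (32 * (Jc / γA) * V₂ + 8 * Jc * Cu * c ^ 2 * ((2 * (1 + Real.sqrt d * ((L : ℝ) - 1)) ^ 2 + 128 / θ ^ 2) * V₄)) *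
        ((B.card : ℝ) * (L : ℝ) ^ d) * Real.exp (-(θ * w / 2))
      ≤ nI * ((2 ^ d * C₀) * b ^ (2 * d + 6) * A ^ 0 * Real.exp (-(θ * (v : ℝ)))) := by
    rw [hE]
    have hc0' : 0 ≤ 32 * (Jc / γA) * V₂ + 8 * Jc * Cu * c ^ 2 * ((2 * (1 + Real.sqrt d * ((L : ℝ) - 1)) ^ 2 + 128 / θ ^ 2) * V₄) := by
      positivity
    calc (32 * (Jc / γA) * V₂ + 8 * Jc * Cu * c ^ 2 * ((2 * (1 + Real.sqrt d * ((L : ℝ) - 1)) ^ 2 + 128 / θ ^ 2) * V₄)) *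
          ((B.card : ℝ) * (L : ℝ) ^ d) * Real.exp (-(θ * (v : ℝ)))
        ≤ (C₀ * b ^ 6) * (nI * (2 ^ d * b ^ (2 * d))) * Real.exp (-(θ * (v : ℝ))) := by
          gcongr
      _ = nI * ((2 ^ d * C₀) * b ^ (2 * d + 6) * A ^ 0 * Real.exp (-(θ * (v : ℝ)))) := by
          rw [pow_zero, pow_add]; ring
  -- Step 3: the decay atom in both regimes
  have hatom := decay_atom_le_snd (C := 2 ^ d * C₀) (ρ₄ := ρ₄) hC2 hA hb hb₀ hρ₃ hρ₄ hθ.le (Nat.cast_nonneg v) hreg hM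
    (2 * d + 6) 0
  rw [Nat.factorial_zero, Nat.cast_one, mul_one] at hatom
  -- Step 4: into `errTerm`
  have hS0 : 0 ≤ 2 ^ d * C₀ * (((2 * d + 6).factorial : ℝ) + b₀ ^ (2 * d + 6) * Real.exp (ρ₃ * b₀ ^ (3 / 2 : ℝ))) := by
    positivity
  have herr := le_errTerm_of_le_snd (ρ₁ := ρ₁) (ρ₂ := ρ₂) (t := t) hatom hS0 hA hb0
  have hfinal : nI * ((2 ^ d * C₀) * b ^ (2 * d + 6) * A ^ 0 * Real.exp (-(θ * (v : ℝ)))) ≤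
      nI * errTerm (2 ^ d * C₀ * (((2 * d + 6).factorial : ℝ) + b₀ ^ (2 * d + 6) * Real.exp (ρ₃ * b₀ ^ (3 / 2 : ℝ))))
        ρ₁ ρ₂ ρ₃ ρ₄ A b t := mul_le_mul_of_nonneg_left herr hnI
  exact hclosed.trans (hnormal.trans hfinal)

/-- **THE PRICE OF THE CONDITIONAL / UPPER CLASS STEP IN THE LEDGER, BOTH REGIMES** — `two_mul_price_le_errTerm` for the price displayed in
`…KernelSect5PavementChainUpper.upperPavementChainCond` (cross rows over `Λ′ ∖ (C′ ∪ Γ₁(B))`), same closed constant `S_P`.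
[cite: BenfattoEtAl1978, (4.6) p.152, §5 (5.36) p.159 «Collecting all the errors» (class substitute; ours); Balaban1985BackgroundPropagators, Sect. E p.428] -/
theorem two_mul_price_union_le_errTerm {Λ C B I : Finset (B1Eq324BenfattoLemma.Site d)} {θ Jc γA Cu c b b₀ Mreg ρ₁ ρ₂ ρ₃ ρ₄ A nI : ℝ}
    {L w v : ℕ} {t : ℕ} (hθ : 0 < θ) (hJc : 0 ≤ Jc) (hγA : 0 < γA) (hCu : 0 ≤ Cu) (hL : 0 < L) (hB : B.Nonempty)
    (hBI : ∀ m ∈ B, ∃ x ∈ box L m, x ∈ I)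
    (hW1 : 1 ≤ θ * w) (hW2 : 4 * Jc / γA ≤ (θ * w) ^ 2)
    (hb : 1 ≤ b) (hc0 : 0 ≤ c) (hcb : c ≤ b) (hLb : (L : ℝ) ≤ 2 * b ^ 2) (hwv : w = 2 * v) (hv : 1 ≤ v)
    (hBn : (B.card : ℝ) ≤ nI) (hA : 0 ≤ A) (hb₀ : 0 ≤ b₀) (hρ₃ : 0 ≤ ρ₃) (hρ₄ : 1 ≤ ρ₄)
    (hreg : b₀ ≤ b → Mreg * b ^ (3 / 2 : ℝ) ≤ (v : ℝ)) (hM : ρ₃ + 1 ≤ θ * Mreg) :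
    2 * ((∑ y : ↥(Λ \ (C ∪ corridors L w B)), Jc / (Real.cosh (θ * max (w : ℝ) (distToRegion (B.biUnion (box L)) y)) - 1)) /
          (γA - Jc / (Real.cosh (θ * w) - 1)) +
        (Cu * c ^ 2 *
          ∑ y : ↥(Λ \ (C ∪ corridors L w B)), Jc / (Real.cosh (θ * max (w : ℝ) (distToRegion (B.biUnion (box L)) y)) - 1) *
            (1 + distToRegion I y) ^ 2) / 2)
      ≤ nI * errTerm
          ((2 ^ d * (32 * (Jc / γA) * (2 / (1 - Real.exp (-(θ / 2 / Real.sqrt d))) * Real.exp (θ / 2 / Real.sqrt d)) ^ d +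
              8 * Jc * Cu * (2 * (1 + 2 * Real.sqrt d) ^ 2 + 128 / θ ^ 2) *
                (2 / (1 - Real.exp (-(θ / 4 / Real.sqrt d))) * Real.exp (θ / 4 / Real.sqrt d)) ^ d)) *
            (((2 * d + 6).factorial : ℝ) + b₀ ^ (2 * d + 6) * Real.exp (ρ₃ * b₀ ^ (3 / 2 : ℝ))))
          ρ₁ ρ₂ ρ₃ ρ₄ A b t := by
  have e1 : ∑ y : ↥(Λ \ (C ∪ corridors L w B)), Jc / (Real.cosh (θ * max (w : ℝ) (distToRegion (B.biUnion (box L)) y)) - 1) =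
      ∑ y : ↥((Λ \ C) \ corridors L w B), Jc / (Real.cosh (θ * max (w : ℝ) (distToRegion (B.biUnion (box L)) y)) - 1) :=
    sum_sdiff_union_eq Λ C (corridors L w B) fun y => Jc / (Real.cosh (θ * max (w : ℝ) (distToRegion (B.biUnion (box L)) y)) - 1)
  have e2 : ∑ y : ↥(Λ \ (C ∪ corridors L w B)), Jc / (Real.cosh (θ * max (w : ℝ) (distToRegion (B.biUnion (box L)) y)) - 1) *
        (1 + distToRegion I y) ^ 2 =
      ∑ y : ↥((Λ \ C) \ corridors L w B), Jc / (Real.cosh (θ * max (w : ℝ) (distToRegion (B.biUnion (box L)) y)) - 1) *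
        (1 + distToRegion I y) ^ 2 :=
    sum_sdiff_union_eq Λ C (corridors L w B) fun y =>
      Jc / (Real.cosh (θ * max (w : ℝ) (distToRegion (B.biUnion (box L)) y)) - 1) * (1 + distToRegion I y) ^ 2
  rw [e1, e2]
  exact two_mul_price_le_errTerm (Λ := Λ \ C) hθ hJc hγA hCu hL hB hBI hW1 hW2 hb hc0 hcb hLb hwv hv hBn hA hb₀ hρ₃ hρ₄ hreg hM

/-- **The class Appendix-A terminal loss in the ledger**: the terminal term `4·8^d·e^{−c²/(2·(1/γ_A))}` of
`…KernelSect5PavementChain.lowerPavementChain_appendixA` (seat n08-w5's class Appendix A, diagonal bound `1/γ_A`) at any cut-off `c ≥ γ′·b`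
(`γ′ = γ^{d+1}` on the lower chain) fits the second summand: `≤ (4·8^d·e^{27ρ⁴/4})·e^{−ρ₃b^{3/2}}e^{ρ₄Ab^{ρ₃}}`, `ρ = ρ₃/(2√(γ_A/2)·γ′)^{3/2}` —
`…ErrTermLedger.appendixA_term_le_snd` at `k₁ = 4·8^d`, `k₂ = γ_A/2` after `c²/(2(1/γ_A)) = (γ_A/2)c²` (`0 < γ′`, `0 < γ_A`, `b, A, ρ₄ ≥ 0`).
[cite: BenfattoEtAl1978, Appendix A (A.1)–(A.2) p.161, (4.7) p.152; Balaban1985BackgroundPropagators, Sect. E p.428 (class form; ours)] -/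
theorem appendixA_class_term_le_snd {γ' γA b c A ρ₃ ρ₄ : ℝ} (hγ' : 0 < γ') (hγA : 0 < γA) (hb : 0 ≤ b) (hc : γ' * b ≤ c) (hA : 0 ≤ A)
    (hρ₄ : 0 ≤ ρ₄) :
    4 * 8 ^ d * Real.exp (-(c ^ 2 / (2 * (1 / γA)))) ≤
      (4 * 8 ^ d * Real.exp (27 / 4 * (ρ₃ / (2 * Real.sqrt (γA / 2) * γ') ^ (3 / 2 : ℝ)) ^ 4)) *
        (Real.exp (-(ρ₃ * b ^ (3 / 2 : ℝ))) * Real.exp (ρ₄ * A * b ^ ρ₃)) := by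
  have hγb : 0 ≤ γ' * b := mul_nonneg hγ'.le hb
  have hmono : Real.exp (-(c ^ 2 / (2 * (1 / γA)))) ≤ Real.exp (-(γA / 2 * (γ' * b) ^ 2)) := by
    rw [Real.exp_le_exp]
    have hsq : (γ' * b) ^ 2 ≤ c ^ 2 := pow_le_pow_left₀ hγb hc 2
    have h : c ^ 2 / (2 * (1 / γA)) = γA / 2 * c ^ 2 := by field_simp
    rw [h]
    nlinarith
  refine le_trans (mul_le_mul_of_nonneg_left hmono (by positivity)) ?_
  exact appendixA_term_le_snd (by positivity) (by positivity) hγ' hb hA hρ₄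

/-- **Summing a per-step ledger entry over the steps**: if `x_k ≤ X` for every `k < n` then `Σ_{k<n} x_k ≤ n·X` — the shape in which the class
assembler adds `Σ_{k ≤ d} 2P_k` to its `hledger` (each `2P_k ≤ nI·errTerm S_P …` by `two_mul_price_le_errTerm` at the cut-off `c = b_k ≤ b`).
[cite: BenfattoEtAl1978, §5 p.159 «Collecting all the errors made in this process»] -/
theorem sum_le_card_mul_of_le {x : ℕ → ℝ} {X : ℝ} {n : ℕ} (h : ∀ k < n, x k ≤ X) :
    ∑ k ∈ Finset.range n, x k ≤ n * X := by
  calc ∑ k ∈ Finset.range n, x k ≤ ∑ _k ∈ Finset.range n, X := Finset.sum_le_sum fun k hk => h k (Finset.mem_range.mp hk)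
    _ = n * X := by rw [Finset.sum_const, Finset.card_range, nsmul_eq_mul]

end Ledger

/-! ## §4  The parameter scheme with a narrow width `v₀`: `v = if b₀ ≤ b then ⌈M_reg·b^{3/2}⌉₊ else v₀`, `w = 2v`, `L = ⌈b²⌉₊` -/

section Regime

variable {b b₀ M : ℝ} {d v₀ : ℕ}

/-- `1 ≤ v` in both regimes (`v₀ ≥ 1`, `0 < M·b^{3/2}`). [cite: BenfattoEtAl1978, §5 p.154, p.159] -/
theorem one_le_regimeV₀ (hM : 0 < M) (hb : 1 ≤ b) (hv₀ : 1 ≤ v₀) : 1 ≤ (if b₀ ≤ b then ⌈M * b ^ (3 / 2 : ℝ)⌉₊ else v₀) := by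
  split_ifs with h
  · exact Nat.one_le_iff_ne_zero.mpr (Nat.ceil_pos.mpr (mul_pos hM (Real.rpow_pos_of_pos (by linarith) _))).ne'
  · exact hv₀

/-- **The narrow width is a lower bound in BOTH regimes**: `v₀ ≤ v` as soon as `v₀ ≤ M·b₀^{3/2}` (`M, b₀ ≥ 0`) — in the wide regime
`v₀ ≤ M·b₀^{3/2} ≤ M·b^{3/2} ≤ ⌈M·b^{3/2}⌉₊`.  So every width row proved at `v₀` holds along the whole scheme.
[cite: BenfattoEtAl1978, §5 p.154, p.159 (class substitute; ours)] -/
theorem le_regimeV₀ (hM : 0 ≤ M) (hb₀ : 0 ≤ b₀) (hv₀M : (v₀ : ℝ) ≤ M * b₀ ^ (3 / 2 : ℝ)) :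
    v₀ ≤ (if b₀ ≤ b then ⌈M * b ^ (3 / 2 : ℝ)⌉₊ else v₀) := by
  split_ifs with h
  · have hmono : M * b₀ ^ (3 / 2 : ℝ) ≤ M * b ^ (3 / 2 : ℝ) :=
      mul_le_mul_of_nonneg_left (Real.rpow_le_rpow hb₀ h (by norm_num)) hM
    have hreal : (v₀ : ℝ) ≤ (⌈M * b ^ (3 / 2 : ℝ)⌉₊ : ℝ) := (hv₀M.trans hmono).trans (Nat.le_ceil _)
    exact_mod_cast hreal
  · exact le_rfl

/-- **The wide regime has wide corridors**: `b₀ ≤ b → M·b^{3/2} ≤ v` (the `hreg` of `two_mul_price_le_errTerm` / `…LedgerDischarge.decay_atom_le_snd`).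
[cite: BenfattoEtAl1978, §5 p.159] -/
theorem wide_of_regime₀ (h : b₀ ≤ b) : M * b ^ (3 / 2 : ℝ) ≤ ((if b₀ ≤ b then ⌈M * b ^ (3 / 2 : ℝ)⌉₊ else v₀ : ℕ) : ℝ) := by
  rw [if_pos h]
  exact Nat.le_ceil _

/-- **THE DISPLACED PAVEMENTS FIT IN BOTH REGIMES, narrow width `v₀`**: with `L = ⌈b²⌉₊`, `v` as above and `w = 2v`, `(d+1)·2(2w+v) ≤ L` as soon as
`10(d+1)·v₀ ≤ b²` (bounded regime) and `(10(d+1)(M+1))² ≤ b₀` (wide regime, `…ErrTermLedger.shifts_fit`), `M ≥ 0`.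
[cite: BenfattoEtAl1978, §5 p.154 «we can arrange the pavements», p.159 «displaced by b²/2»] -/
theorem shifts_fit_regime₀ (hM : 0 ≤ M) (hb₀ : (10 * ((d : ℝ) + 1) * (M + 1)) ^ 2 ≤ b₀) (hb : 10 * ((d : ℝ) + 1) * v₀ ≤ b ^ 2) :
    (d + 1) * (2 * (2 * (2 * (if b₀ ≤ b then ⌈M * b ^ (3 / 2 : ℝ)⌉₊ else v₀)) + (if b₀ ≤ b then ⌈M * b ^ (3 / 2 : ℝ)⌉₊ else v₀))) ≤
      ⌈b ^ 2⌉₊ := by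
  split_ifs with h
  · exact shifts_fit hM (hb₀.trans h)
  · have h10 : (d + 1) * (2 * (2 * (2 * v₀) + v₀)) = (d + 1) * 10 * v₀ := by ring
    rw [h10]
    have hreal : (((d + 1) * 10 * v₀ : ℕ) : ℝ) ≤ (⌈b ^ 2⌉₊ : ℝ) := by
      push_cast
      nlinarith [sq_le_natCeil_sq b]
    exact_mod_cast hreal

/-- **THE TWO WIDTH ROWS ALONG THE SCHEME**: if `1 ≤ 2θv₀` and `4J_c/γ_A ≤ (2θv₀)²` (`θ > 0`) then for every `v ≥ v₀` the corridor width `w = 2v`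
satisfies `1 ≤ θw` and `4J_c/γ_A ≤ (θw)²` — the `hW1`/`hW2` of §1–§3, hence the chain's guard (`guard_of_width`), from the narrow width alone
(combine with `le_regimeV₀`). [cite: BenfattoEtAl1978, §5 (5.13) p.155 (class substitute; ours)] -/
theorem width_rows_of_le {θ Jc γA : ℝ} {v : ℕ} (hθ : 0 < θ) (hW1 : 1 ≤ 2 * θ * v₀) (hW2 : 4 * Jc / γA ≤ (2 * θ * v₀) ^ 2)
    (hv : v₀ ≤ v) :
    1 ≤ θ * ((2 * v : ℕ) : ℝ) ∧ 4 * Jc / γA ≤ (θ * ((2 * v : ℕ) : ℝ)) ^ 2 := by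
  have hvv : (v₀ : ℝ) ≤ v := by exact_mod_cast hv
  have hcast : θ * ((2 * v : ℕ) : ℝ) = 2 * θ * v := by push_cast; ring
  rw [hcast]
  have hmono : 2 * θ * v₀ ≤ 2 * θ * v := mul_le_mul_of_nonneg_left hvv (by linarith)
  have h0 : 0 ≤ 2 * θ * (v₀ : ℝ) := by positivity
  exact ⟨hW1.trans hmono, hW2.trans (pow_le_pow_left₀ h0 hmono 2)⟩

/-- **The terminal cut-off row of the class chain from a threshold**: `4·(1/γ_A) ≤ (γⁿb)²` (the `hbterm` of
`…KernelSect5PavementChain.lowerPavementChain_appendixA` at `b_{d+1} = γ^{d+1}b`) as soon as `2/(γⁿ√γ_A) ≤ b` (`0 < γ`, `0 < γ_A`) — a free-field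
threshold. [cite: BenfattoEtAl1978, §5 p.154 «After (d + 1) steps», Appendix A (A.2) p.161] -/
theorem terminal_cutoff_of_threshold {γ γA : ℝ} {n : ℕ} (hγ : 0 < γ) (hγA : 0 < γA) (hb : 2 / (γ ^ n * Real.sqrt γA) ≤ b) :
    4 * (1 / γA) ≤ (γ ^ n * b) ^ 2 := by
  have hγn : 0 < γ ^ n := pow_pos hγ n
  have hs : 0 < Real.sqrt γA := Real.sqrt_pos.mpr hγA
  have h1 : 2 / Real.sqrt γA ≤ γ ^ n * b := by
    have := mul_le_mul_of_nonneg_left hb hγn.le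
    rwa [mul_div_assoc', show γ ^ n * 2 / (γ ^ n * Real.sqrt γA) = 2 / Real.sqrt γA by field_simp] at this
  have h0 : 0 ≤ 2 / Real.sqrt γA := by positivity
  have h2 : (2 / Real.sqrt γA) ^ 2 = 4 * (1 / γA) := by
    rw [div_pow, Real.sq_sqrt hγA.le]; ring
  rw [← h2]
  exact pow_le_pow_left₀ h0 h1 2

end Regime

/-! ## §5 (v1.1)  The CLOSED price in nI-form — the socket shape of the class ledger packs -/

section ClosedNI

variable {d : ℕ}

/-- **THE CLOSED PRICE IN nI-FORM (v1.1; socket shape of the class ledger packs).**  Once the assembler has majorised the step's price by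
`two_mul_price_le_closed` and its box count by `|B| ≤ N ≤ nI` (print: `N = |B_k| ≤ |J_k| ≤ |I|`), the resulting CLOSED term
`(32(J_c/γ_A)V_d(θ/2) + 8J_c·C_u·c²·(2(1+√d(L−1))² + 128/θ²)·V_d(θ/4))·(N·L^d)·e^{−θw/2}` fits `nI·errTerm S_P ρ₁ ρ₂ ρ₃ ρ₄ A b t` with the same closed
`S_P` as `two_mul_price_le_errTerm`, in both regimes (`L ≤ 2b²`, `w = 2v`, `b₀ ≤ b → M_reg·b^{3/2} ≤ v`, `ρ₃ + 1 ≤ θ·M_reg`, cut-off `0 ≤ c ≤ b`, `b ≥ 1`,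
`0 ≤ N ≤ nI`, `A ≥ 0`) — pure real analysis, no pavement data: this is the form in which the price enters the nI-form LEDGER of the class packs
(`…KernelSect5LedgerDischargeLower/Upper`), exactly as print's counts entered `…Sect5LedgerDischargeLower.lowerpack` as `nI`-multiples.
[cite: BenfattoEtAl1978, (4.7) p.152, §5 p.159 «Collecting all the errors made in this process» (class substitute; ours); Balaban1985BackgroundPropagators, Sect. E p.428] -/
theorem closed_price_le_errTerm {θ Jc γA Cu c b b₀ Mreg ρ₁ ρ₂ ρ₃ ρ₄ A N nI : ℝ} {L w v : ℕ} {t : ℕ}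
    (hθ : 0 < θ) (hJc : 0 ≤ Jc) (hγA : 0 < γA) (hCu : 0 ≤ Cu)
    (hb : 1 ≤ b) (hc0 : 0 ≤ c) (hcb : c ≤ b) (hLb : (L : ℝ) ≤ 2 * b ^ 2) (hwv : w = 2 * v)
    (hN0 : 0 ≤ N) (hN : N ≤ nI) (hA : 0 ≤ A) (hb₀ : 0 ≤ b₀) (hρ₃ : 0 ≤ ρ₃) (hρ₄ : 1 ≤ ρ₄)
    (hreg : b₀ ≤ b → Mreg * b ^ (3 / 2 : ℝ) ≤ (v : ℝ)) (hM : ρ₃ + 1 ≤ θ * Mreg) :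
    (32 * (Jc / γA) * (2 / (1 - Real.exp (-(θ / 2 / Real.sqrt d))) * Real.exp (θ / 2 / Real.sqrt d)) ^ d +
          8 * Jc * Cu * c ^ 2 *
            ((2 * (1 + Real.sqrt d * ((L : ℝ) - 1)) ^ 2 + 128 / θ ^ 2) *
              (2 / (1 - Real.exp (-(θ / 4 / Real.sqrt d))) * Real.exp (θ / 4 / Real.sqrt d)) ^ d)) *
        (N * (L : ℝ) ^ d) * Real.exp (-(θ * w / 2))
      ≤ nI * errTerm
          ((2 ^ d * (32 * (Jc / γA) * (2 / (1 - Real.exp (-(θ / 2 / Real.sqrt d))) * Real.exp (θ / 2 / Real.sqrt d)) ^ d +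
              8 * Jc * Cu * (2 * (1 + 2 * Real.sqrt d) ^ 2 + 128 / θ ^ 2) *
                (2 / (1 - Real.exp (-(θ / 4 / Real.sqrt d))) * Real.exp (θ / 4 / Real.sqrt d)) ^ d)) *
            (((2 * d + 6).factorial : ℝ) + b₀ ^ (2 * d + 6) * Real.exp (ρ₃ * b₀ ^ (3 / 2 : ℝ))))
          ρ₁ ρ₂ ρ₃ ρ₄ A b t := by
  -- abbreviations
  set V₂ : ℝ := (2 / (1 - Real.exp (-(θ / 2 / Real.sqrt d))) * Real.exp (θ / 2 / Real.sqrt d)) ^ d with hV₂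
  set V₄ : ℝ := (2 / (1 - Real.exp (-(θ / 4 / Real.sqrt d))) * Real.exp (θ / 4 / Real.sqrt d)) ^ d with hV₄
  set K₀ : ℝ := 2 * (1 + 2 * Real.sqrt d) ^ 2 + 128 / θ ^ 2 with hK₀
  set C₀ : ℝ := 32 * (Jc / γA) * V₂ + 8 * Jc * Cu * K₀ * V₄ with hC₀
  have hb0 : 0 ≤ b := zero_le_one.trans hb
  have hV₂0 : 0 ≤ V₂ := by rw [hV₂]; exact growth_nonneg (by positivity) d
  have hV₄0 : 0 ≤ V₄ := by rw [hV₄]; exact growth_nonneg (by positivity) d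
  have hK₀0 : 0 ≤ K₀ := by rw [hK₀]; positivity
  have hC₀0 : 0 ≤ C₀ := by rw [hC₀]; positivity
  have hnI : 0 ≤ nI := hN0.trans hN
  -- polynomial normal form `≤ nI·(2^d C₀)·b^{2d+6}·e^{−θv}`
  have hmom : 2 * (1 + Real.sqrt d * ((L : ℝ) - 1)) ^ 2 + 128 / θ ^ 2 ≤ K₀ * b ^ 4 := by
    rw [hK₀]; exact moment_const_le hθ hb hLb
  have hc2 : c ^ 2 ≤ b ^ 2 := pow_le_pow_left₀ hc0 hcb 2
  have hLd : (L : ℝ) ^ d ≤ 2 ^ d * b ^ (2 * d) := by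
    calc (L : ℝ) ^ d ≤ (2 * b ^ 2) ^ d := pow_le_pow_left₀ (Nat.cast_nonneg L) hLb d
      _ = 2 ^ d * b ^ (2 * d) := by rw [mul_pow, pow_mul]
  have hP : N * (L : ℝ) ^ d ≤ nI * (2 ^ d * b ^ (2 * d)) := mul_le_mul hN hLd (by positivity) hnI
  have hE : Real.exp (-(θ * w / 2)) = Real.exp (-(θ * (v : ℝ))) := by
    rw [hwv]; push_cast; ring_nf
  have hb6 : 1 ≤ b ^ 6 := one_le_pow₀ hb
  have hfirst : 32 * (Jc / γA) * V₂ ≤ 32 * (Jc / γA) * V₂ * b ^ 6 := le_mul_of_one_le_right (by positivity) hb6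
  have hsecond : 8 * Jc * Cu * c ^ 2 * ((2 * (1 + Real.sqrt d * ((L : ℝ) - 1)) ^ 2 + 128 / θ ^ 2) * V₄) ≤
      8 * Jc * Cu * K₀ * V₄ * b ^ 6 := by
    have h1 : 8 * Jc * Cu * c ^ 2 * ((2 * (1 + Real.sqrt d * ((L : ℝ) - 1)) ^ 2 + 128 / θ ^ 2) * V₄) ≤
        8 * Jc * Cu * b ^ 2 * ((K₀ * b ^ 4) * V₄) := by
      gcongr
    refine h1.trans (le_of_eq ?_)
    ring
  have hconst : (32 * (Jc / γA) * V₂ + 8 * Jc * Cu * c ^ 2 * ((2 * (1 + Real.sqrt d * ((L : ℝ) - 1)) ^ 2 + 128 / θ ^ 2) * V₄))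
      ≤ C₀ * b ^ 6 := by
    rw [hC₀]
    linarith [hfirst, hsecond]
  have hC2 : 0 ≤ 2 ^ d * C₀ := by positivity
  have hnormal : (32 * (Jc / γA) * V₂ + 8 * Jc * Cu * c ^ 2 * ((2 * (1 + Real.sqrt d * ((L : ℝ) - 1)) ^ 2 + 128 / θ ^ 2) * V₄)) *
        (N * (L : ℝ) ^ d) * Real.exp (-(θ * w / 2))
      ≤ nI * ((2 ^ d * C₀) * b ^ (2 * d + 6) * A ^ 0 * Real.exp (-(θ * (v : ℝ)))) := by
    rw [hE]
    have hc0' : 0 ≤ 32 * (Jc / γA) * V₂ + 8 * Jc * Cu * c ^ 2 * ((2 * (1 + Real.sqrt d * ((L : ℝ) - 1)) ^ 2 + 128 / θ ^ 2) * V₄) := by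
      positivity
    calc (32 * (Jc / γA) * V₂ + 8 * Jc * Cu * c ^ 2 * ((2 * (1 + Real.sqrt d * ((L : ℝ) - 1)) ^ 2 + 128 / θ ^ 2) * V₄)) *
          (N * (L : ℝ) ^ d) * Real.exp (-(θ * (v : ℝ)))
        ≤ (C₀ * b ^ 6) * (nI * (2 ^ d * b ^ (2 * d))) * Real.exp (-(θ * (v : ℝ))) := by
          gcongr
      _ = nI * ((2 ^ d * C₀) * b ^ (2 * d + 6) * A ^ 0 * Real.exp (-(θ * (v : ℝ)))) := by
          rw [pow_zero, pow_add]; ring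
  have hatom := decay_atom_le_snd (C := 2 ^ d * C₀) (ρ₄ := ρ₄) hC2 hA hb hb₀ hρ₃ hρ₄ hθ.le (Nat.cast_nonneg v) hreg hM
    (2 * d + 6) 0
  rw [Nat.factorial_zero, Nat.cast_one, mul_one] at hatom
  have hS0 : 0 ≤ 2 ^ d * C₀ * (((2 * d + 6).factorial : ℝ) + b₀ ^ (2 * d + 6) * Real.exp (ρ₃ * b₀ ^ (3 / 2 : ℝ))) := by
    positivity
  have herr := le_errTerm_of_le_snd (ρ₁ := ρ₁) (ρ₂ := ρ₂) (t := t) hatom hS0 hA hb0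
  exact hnormal.trans (mul_le_mul_of_nonneg_left herr hnI)

end ClosedNI

end Literature.MathematicalPhysics.QuantumFieldTheory.Balaban1983to89.B1Eq324BenfattoKernelSect5LedgerPrice

end
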